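import Mathlib
import HarnessLib
import Summits.Ventures.LatticeQCDFlow.Scoring.DoeblinSkeleton
import Summits.Ventures.LatticeQCDFlow.Scoring.ChainMeanSquareError
import Summits.Ventures.LatticeQCDFlow.Scoring.ChainConfidenceInterval

/-!
# Thinning a Doeblin chain: `k` updates per recorded sample are minorised by the invariant law with
# the constant `ε_k = 1 − (1 − ε)^k`, and every any-start certificate of the row holds with `ε_k`

HONEST FRAMING: exact (Metropolis-corrected) sampling algorithms for lattice gauge theory;
figures of merit are autocorrelation/cost numbers at stated couplings and volumes; no
continuum-physics claim.

Venture `LatticeQCDFlow` (cell pub-lqcd), topic `Scoring`; FANOUT row 8 (`s0-cpn-nemc`, GEN-14).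
NEW WORK of the cell, not a published result; no definition is introduced.  The row's any-start
certificates (`Scoring/ChainMeanSquareError.lean`, `Scoring/ChainHoeffding.lean`,
`Scoring/ChainConfidenceInterval.lean`, `Scoring/ChainBurnIn.lean`, …) take ONE input: a Doeblin
minorisation of the simulated kernel by its invariant law, `κ(x, ·) ≥ ε π`.  A sampler that RECORDS
only every `k`-th state simulates the kernel `κ^k` (row 9's `Exactness.nHit κ k = κ ∘ₖ ⋯ ∘ₖ κ`);
`Scoring/DoeblinSkeleton.lean` observed that `ε` itself is a `k`-step constant
(`doeblin_nHit_succ_of_doeblin`) and worked with `m`-step constants as HYPOTHESES.  This file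
computes the `k`-step constant a one-step certificate actually delivers when the minorising measure
is the invariant law: `κ^k(x, ·) ≥ (1 − (1 − ε)^k) π` — geometrically close to the independent
sampler's `ε = 1` — by iterating the splitting `κ = ε π + (1 − ε) R` of the tree's Doeblin
formalisation (`Literature.Probability.MarkovChains.Doeblin.residualKernel`, Meyn–Tweedie 1993
Thm 16.2.4, used through `apply_eq_add_residual`; `π R = π` is
`Scoring/KernelTransitionOperator.invariant_residualKernel`).  Printed counterpart NAMED ONLY: the
`m`-step small-set / minorisation calculus (Meyn–Tweedie 1993 §5.5; Roberts–Rosenthal 2004,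
*General state space Markov chains and MCMC algorithms*, §3.3), nothing cited as a fact.

## Content (`κ` Markov with invariant probability law `π`; ONE-STEP DOEBLIN BY `π`:
## `κ(x, B) ≥ ε π(B)`; `ε_k := 1 − (1 − ε)^k`)

* `eps_add_one_sub_mul`, `toReal_one_sub_pow`, `eps_nHit_pos`, `le_one_sub_pow` — the arithmetic
  of `ε_k` (in `ℝ≥0∞` and in `ℝ`): `ε + (1 − ε) ε_k = ε_{k+1}`, `ε_k.toReal = 1 − (1 − ε.toReal)^k`,
  `ε_k > 0` for `ε > 0`, `k ≥ 1`, `ε ≤ ε_k` (and `ε_k ≥ 1 − e^{−kε} → 1` geometrically, the tree's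
  `Literature.Computability.Complexity.orLayer_ge_exp`, not restated);
* `mul_lintegral_le_of_setwise` — a setwise domination `c π ≤ ν` dominates integrals;
* **`doeblin_nHit_of_doeblin`** — THE `k`-STEP CONSTANT: `π` invariant and `κ(x, ·) ≥ ε π` for all
  `x` ⇒ `(nHit κ k)(x, ·) ≥ (1 − (1 − ε)^k) π` for all `k, x` (induction: split the last step,
  `∫ R(y, B) κ^k(x, dy) ≥ ε_k ∫ R(y, B) π(dy) = ε_k π(B)` by `π R = π`; the degenerate `ε = 1` is
  `κ(x, ·) = π`); `nHit_nHit`, **`doeblin_nHit_mul_of_doeblin_nHit`** — certificates COMPOSE: an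
  `m`-step constant `ε_m` is an `(m j)`-step constant `1 − (1 − ε_m)^j`;
* the RECORD-EVERY-`k`-TH-STATE sampler (kernel `nHit κ k`, invariant law `π`, from ANY start `μ₀`),
  all by instantiating the row's files at `ε_k`:
  **`thinnedChain_mse_le_of_doeblin`** —
  `E_{μ₀}[((1/m) Σ_{i<m} f(X_i) − πf)²] ≤ (2/ε_k − 1) Var_π f/m + 16 C'²/(ε_k² m²)`;
  **`thinnedChain_confidence_of_doeblin`** —
  `P_{μ₀}(|(1/m) Σ_{i<m} f(X_i) − πf| > 4C'/(ε_k m) + √(8 C'² log(2/η)/(ε_k² m))) ≤ η`;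
  `thinnedChain_bias_le_of_doeblin` — `|E_{μ₀} f(X_t) − πf| ≤ (1 − ε_k/2)ᵗ C'`;
  `thinnedChain_tauInt_le_of_doeblin` — `τ_int(f; κ^k) ≤ 1/ε_k − 1/2` in units of RECORDED samples.

Reading (value-free): a one-step certificate `ε` makes `k` consecutive updates a certificate
`1 − (1 − ε)^k ≥ 1 − e^{−kε}` — after `k ≥ log(1/η)/ε` updates per record the recorded states are
certified `η`-close to independent draws from `π` in every bound of the row (variance factor
`2/ε_k − 1 ≤ (1 + η)/(1 − η)`, burn-in factor `(1 − ε_k/2)ᵗ ≤ ((1 + η)/2)ᵗ`), from any start; and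
block certificates compose multiplicatively in the deficit `1 − ε`.  What thinning does NOT do is
beat the full-run estimator at equal updates — that comparison (MacEachern–Berliner, and the
geometric family `k τ(ρ ∘ (k·)) ≥ τ(ρ)`) is row 11's `Scoring/Thinning.lean` and is not restated.
NOT CLAIMED: any `ε` for a concrete sampler; that the path law of every `k`-th state of the
`κ`-chain is the `κ^k`-chain's (only the kernel-level statements are proved; the recorded-state
sampler is MODELLED as the chain with kernel `nHit κ k`); unbounded observables.
-/

noncomputable section

namespace Summit.Ventures.LatticeQCDFlow.Scoring

open MeasureTheory ProbabilityTheory Filter Finset Literature.Probability.MarkovChains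
open Summit.Ventures.LatticeQCDFlow.Exactness
open scoped ENNReal

variable {Ω : Type*} [MeasurableSpace Ω]

/-! ### The arithmetic of `ε_k = 1 − (1 − ε)^k` -/

section Arithmetic

/-- `ε + (1 − ε)(1 − (1 − ε)^k) = 1 − (1 − ε)^{k+1}` in `ℝ≥0∞`, for `ε ≤ 1`. -/
theorem eps_add_one_sub_mul (ε : ℝ≥0∞) (hε1 : ε ≤ 1) (k : ℕ) :
    ε + (1 - ε) * (1 - (1 - ε) ^ k) = 1 - (1 - ε) ^ (k + 1) := by
  set a : ℝ≥0∞ := 1 - ε with ha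
  have hatop : a ≠ ⊤ := ne_top_of_le_ne_top ENNReal.one_ne_top tsub_le_self
  have ha1 : a ≤ 1 := tsub_le_self
  have hak : a ^ (k + 1) ≤ a := by
    calc a ^ (k + 1) = a ^ k * a := pow_succ a k
      _ ≤ 1 * a := by gcongr; exact pow_le_one₀ zero_le ha1
      _ = a := one_mul a
  have hcktop : a ^ (k + 1) ≠ ⊤ := ne_top_of_le_ne_top hatop hak
  have hmul : a * (1 - a ^ k) = a - a ^ (k + 1) := by
    rw [ENNReal.mul_sub (fun _ _ => hatop), mul_one, ← pow_succ']
  have hεa : ε + a = 1 := by rw [ha]; exact add_tsub_cancel_of_le hε1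
  rw [hmul, ← (ENNReal.cancel_of_ne hcktop).add_tsub_assoc_of_le hak ε, hεa]

/-- `(1 − (1 − ε)^k).toReal = 1 − (1 − ε.toReal)^k` for `ε ≤ 1`. -/
theorem toReal_one_sub_pow (ε : ℝ≥0∞) (hε1 : ε ≤ 1) (k : ℕ) :
    (1 - (1 - ε) ^ k).toReal = 1 - (1 - ε.toReal) ^ k := by
  have ha1 : (1 - ε) ^ k ≤ 1 := pow_le_one₀ zero_le tsub_le_self
  rw [ENNReal.toReal_sub_of_le ha1 ENNReal.one_ne_top, ENNReal.toReal_pow,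
    ENNReal.toReal_sub_of_le hε1 ENNReal.one_ne_top, ENNReal.toReal_one]

/-- `0 < 1 − (1 − ε)^k` for `ε > 0` and `k ≥ 1`. -/
theorem eps_nHit_pos {ε : ℝ≥0∞} (hε0 : 0 < ε) {k : ℕ} (hk : k ≠ 0) :
    0 < 1 - (1 - ε) ^ k := by
  have h1 : 1 - ε < 1 := ENNReal.sub_lt_self ENNReal.one_ne_top one_ne_zero hε0.ne'
  have h2 : (1 - ε) ^ k ≤ (1 - ε) ^ 1 :=
    pow_le_pow_right_of_le_one' tsub_le_self (Nat.one_le_iff_ne_zero.2 hk)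
  rw [pow_one] at h2
  exact tsub_pos_of_lt (h2.trans_lt h1)

/-- `ε ≤ 1 − (1 − ε)^k` for `ε ≤ 1` and `k ≥ 1`: thinning never worsens the constant. -/
theorem le_one_sub_pow {ε : ℝ≥0∞} (hε1 : ε ≤ 1) {k : ℕ} (hk : k ≠ 0) : ε ≤ 1 - (1 - ε) ^ k := by
  have h2 : (1 - ε) ^ k ≤ (1 - ε) ^ 1 :=
    pow_le_pow_right_of_le_one' tsub_le_self (Nat.one_le_iff_ne_zero.2 hk)
  rw [pow_one] at h2
  calc ε = 1 - (1 - ε) := (ENNReal.sub_sub_cancel ENNReal.one_ne_top hε1).symm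
    _ ≤ 1 - (1 - ε) ^ k := tsub_le_tsub_left h2 1

end Arithmetic

/-! ### The `k`-step minorisation constant -/

section Minorisation

variable {κ : Kernel Ω Ω} [IsMarkovKernel κ] {π : Measure Ω} [IsProbabilityMeasure π] {ε : ℝ≥0∞}

omit [IsMarkovKernel κ] [IsProbabilityMeasure π] in
/-- A setwise domination `c π(B) ≤ ν(B)` (measurable `B`) dominates integrals of measurable
functions: `c ∫ g dπ ≤ ∫ g dν`. -/
theorem mul_lintegral_le_of_setwise {ν : Measure Ω} {c : ℝ≥0∞}
    (h : ∀ {B : Set Ω}, MeasurableSet B → c * π B ≤ ν B) (g : Ω → ℝ≥0∞) :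
    c * ∫⁻ y, g y ∂π ≤ ∫⁻ y, g y ∂ν := by
  have hle : c • π ≤ ν := Measure.le_iff.2 fun B hB => by
    rw [Measure.smul_apply, smul_eq_mul]; exact h hB
  calc c * ∫⁻ y, g y ∂π = ∫⁻ y, g y ∂(c • π) := by rw [lintegral_smul_measure, smul_eq_mul]
    _ ≤ ∫⁻ y, g y ∂ν := lintegral_mono' hle le_rfl

/-- **THE `k`-STEP MINORISATION CONSTANT.**  If `π` is an invariant probability law of the Markov
kernel `κ` and `κ(x, B) ≥ ε π(B)` for every state `x` and measurable `B`, then for every `k` and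
every `x`: `κ^k(x, B) ≥ (1 − (1 − ε)^k) π(B)` (`κ^k = nHit κ k`). -/
theorem doeblin_nHit_of_doeblin (hπ : Kernel.Invariant κ π)
    (hmin : ∀ x {B : Set Ω}, MeasurableSet B → ε * π B ≤ κ x B) :
    ∀ (k : ℕ) (x : Ω) {B : Set Ω}, MeasurableSet B → (1 - (1 - ε) ^ k) * π B ≤ nHit κ k x B := by
  have hε1 : ε ≤ 1 := eps_le_one_of_doeblin hmin
  intro k
  induction k with
  | zero => intro x B _; simp
  | succ k ih =>
    intro x B hB
    haveI := isMarkovKernel_nHit κ k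
    rw [nHit_succ, Kernel.comp_apply' _ _ _ hB]
    rcases eq_or_lt_of_le hε1 with h1 | hε
    · -- `ε = 1`: `κ(y, ·) = π` for every `y`
      subst h1
      have hKπ : ∀ y, κ y B = π B := fun y => by
        refine le_antisymm ?_ (by simpa using hmin y hB)
        have hc : π Bᶜ ≤ κ y Bᶜ := by simpa using hmin y hB.compl
        rw [prob_compl_eq_one_sub hB, prob_compl_eq_one_sub hB] at hc
        exact (ENNReal.sub_le_sub_iff_left prob_le_one ENNReal.one_ne_top).1 hc
      simp_rw [hKπ]
      rw [lintegral_const, measure_univ, mul_one]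
      calc (1 - (1 - 1) ^ (k + 1)) * π B ≤ 1 * π B := by gcongr; exact tsub_le_self
        _ = π B := one_mul _
    · -- `ε < 1`: split the last step through the residual kernel `R`, `π R = π`
      haveI := Doeblin.isMarkovKernel_residualKernel (κ := κ) (ν := π) (hmin := hmin) hε
      have hsplit : ∫⁻ y, κ y B ∂(nHit κ k x)
          = ε * π B + (1 - ε) * ∫⁻ y, Doeblin.residualKernel κ π ε hmin y B ∂(nHit κ k x) := by
        have h : (fun y => κ y B)
            = fun y => ε * π B + (1 - ε) * Doeblin.residualKernel κ π ε hmin y B :=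
          funext fun y => Doeblin.apply_eq_add_residual hε y hB
        rw [h, lintegral_add_left measurable_const, lintegral_const, measure_univ, mul_one,
          lintegral_const_mul _ (Kernel.measurable_coe _ hB)]
      have hRπ : ∫⁻ y, Doeblin.residualKernel κ π ε hmin y B ∂π = π B := by
        have hinv := invariant_residualKernel (κ := κ) (π := π) (hmin := hmin) hπ hε
        have h2 : π.bind ⇑(Doeblin.residualKernel κ π ε hmin) = π := hinv.def
        rw [← Measure.bind_apply hB (Kernel.aemeasurable _), h2]
      have hdom : (1 - (1 - ε) ^ k) * π B
          ≤ ∫⁻ y, Doeblin.residualKernel κ π ε hmin y B ∂(nHit κ k x) := by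
        calc (1 - (1 - ε) ^ k) * π B
            = (1 - (1 - ε) ^ k) * ∫⁻ y, Doeblin.residualKernel κ π ε hmin y B ∂π := by rw [hRπ]
          _ ≤ ∫⁻ y, Doeblin.residualKernel κ π ε hmin y B ∂(nHit κ k x) :=
            mul_lintegral_le_of_setwise (fun hB' => ih x hB') _
      rw [hsplit]
      calc (1 - (1 - ε) ^ (k + 1)) * π B
          = ε * π B + (1 - ε) * ((1 - (1 - ε) ^ k) * π B) := by
            rw [← eps_add_one_sub_mul ε hε1 k, add_mul, mul_assoc]
        _ ≤ ε * π B + (1 - ε) * ∫⁻ y, Doeblin.residualKernel κ π ε hmin y B ∂(nHit κ k x) := by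
            gcongr

omit [IsMarkovKernel κ] [IsProbabilityMeasure π] in
/-- Skeletons of skeletons: `nHit (nHit κ m) j = nHit κ (m j)`. -/
theorem nHit_nHit (κ : Kernel Ω Ω) (m j : ℕ) : nHit (nHit κ m) j = nHit κ (m * j) := by
  rw [nHit_eq_pow, nHit_eq_pow, nHit_eq_pow, pow_mul]

/-- **Block certificates compose**: if `π` is invariant for `κ` and the `m`-step kernel satisfies
`κ^m(x, ·) ≥ ε π`, then `κ^{m j}(x, ·) ≥ (1 − (1 − ε)^j) π` for every `j`. -/
theorem doeblin_nHit_mul_of_doeblin_nHit (hπ : Kernel.Invariant κ π) {m : ℕ}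
    (hmin : ∀ x {B : Set Ω}, MeasurableSet B → ε * π B ≤ nHit κ m x B) (j : ℕ) :
    ∀ x {B : Set Ω}, MeasurableSet B → (1 - (1 - ε) ^ j) * π B ≤ nHit κ (m * j) x B := by
  haveI := isMarkovKernel_nHit κ m
  intro x B hB
  rw [← nHit_nHit]
  exact doeblin_nHit_of_doeblin (invariant_nHit hπ m) hmin j x hB

/-- The `k`-step constant in the `e^{−M}` shape of the tree's flow-sampler theorems:
`κ(x, ·) ≥ e^{−M} π` ⇒ `κ^k(x, ·) ≥ (1 − (1 − e^{−M})^k) π`, stated with `ENNReal.ofReal`. -/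
theorem doeblin_nHit_of_doeblin_exp (hπ : Kernel.Invariant κ π) {M : ℝ}
    (hmin : ∀ x {B : Set Ω}, MeasurableSet B → ENNReal.ofReal (Real.exp (-M)) * π B ≤ κ x B)
    (k : ℕ) : ∀ x {B : Set Ω}, MeasurableSet B →
      ENNReal.ofReal (1 - (1 - Real.exp (-M)) ^ k) * π B ≤ nHit κ k x B := by
  intro x B hB
  have h := doeblin_nHit_of_doeblin hπ hmin k x hB
  have hε1 : ENNReal.ofReal (Real.exp (-M)) ≤ 1 := eps_le_one_of_doeblin hmin
  have he1 : Real.exp (-M) ≤ 1 := by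
    have := (ENNReal.ofReal_le_one).1 hε1
    exact this
  have hconv : ENNReal.ofReal (1 - (1 - Real.exp (-M)) ^ k)
      = 1 - (1 - ENNReal.ofReal (Real.exp (-M))) ^ k := by
    have h0 : 0 ≤ 1 - Real.exp (-M) := by linarith
    rw [ENNReal.ofReal_sub _ (pow_nonneg h0 k), ENNReal.ofReal_one, ENNReal.ofReal_pow h0,
      ENNReal.ofReal_sub _ (Real.exp_pos _).le, ENNReal.ofReal_one]
  rw [hconv]
  exact h

end Minorisation

/-! ### The record-every-`k`-th-state sampler: the row's certificates at `ε_k` -/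

section ThinnedChain

variable {κ : Kernel Ω Ω} [IsMarkovKernel κ] {μ₀ : Measure Ω} [IsProbabilityMeasure μ₀]
  {π : Measure Ω} [IsProbabilityMeasure π] {ε : ℝ≥0∞}

/-- **MEAN-SQUARE ERROR OF THE THINNED TIME AVERAGE, ANY START.**  With `π` invariant,
`κ(x, ·) ≥ ε π` (`ε > 0`), `|f| ≤ C`, `C' = C + |πf|`, `ε_k = 1 − (1 − ε)^k` (`k ≥ 1`): the chain
that applies `κ` `k` times per recorded sample (kernel `nHit κ k`), from ANY initial law and for
every `m ≥ 1`, has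
`E[((1/m) Σ_{i<m} f(X_i) − πf)²] ≤ (2/ε_k − 1) Var_π f / m + 16 C'² / (ε_k² m²)`. -/
theorem thinnedChain_mse_le_of_doeblin (hπ : Kernel.Invariant κ π)
    (hmin : ∀ x {B : Set Ω}, MeasurableSet B → ε * π B ≤ κ x B) (hε0 : 0 < ε) {k : ℕ} (hk : k ≠ 0)
    {f : Ω → ℝ} (hf : Measurable f) {C : ℝ} (hC : ∀ x, |f x| ≤ C) {m : ℕ} (hm : m ≠ 0) :
    haveI := isMarkovKernel_nHit κ k
    ∫ x, ((∑ i ∈ Finset.range m, f (x i)) / m - ∫ z, f z ∂π) ^ 2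
        ∂(Kernel.trajMeasure (X := fun _ : ℕ => Ω) μ₀
          (fun n : ℕ => (nHit κ k).comap (fun h : (i : ↥(Finset.Iic n)) → Ω =>
            h ⟨n, Finset.mem_Iic.2 le_rfl⟩) (measurable_pi_apply _)))
      ≤ (2 / (1 - (1 - ε.toReal) ^ k) - 1) * (∫ z, (f z - ∫ y, f y ∂π) ^ 2 ∂π) / m
        + 16 * (C + |∫ z, f z ∂π|) ^ 2 / ((1 - (1 - ε.toReal) ^ k) ^ 2 * (m : ℝ) ^ 2) := by
  haveI := isMarkovKernel_nHit κ k
  have hε1 := eps_le_one_of_doeblin hmin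
  have h := chain_mse_le_of_doeblin (κ := nHit κ k) (μ₀ := μ₀) (invariant_nHit hπ k)
    (doeblin_nHit_of_doeblin hπ hmin k) (eps_nHit_pos hε0 hk) hf hC hm
  rw [toReal_one_sub_pow ε hε1 k, autocov_zero] at h
  exact h

/-- **CERTIFIED CONFIDENCE INTERVAL FOR THE THINNED SAMPLER, ANY START.**  Same hypotheses; for
every `m ≥ 1` and `0 < η ≤ 1`:
`P_{μ₀}(|(1/m) Σ_{i<m} f(X_i) − πf| > 4C'/(ε_k m) + √(8 C'² log(2/η)/(ε_k² m))) ≤ η`. -/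
theorem thinnedChain_confidence_of_doeblin (hπ : Kernel.Invariant κ π)
    (hmin : ∀ x {B : Set Ω}, MeasurableSet B → ε * π B ≤ κ x B) (hε0 : 0 < ε) {k : ℕ} (hk : k ≠ 0)
    {f : Ω → ℝ} (hf : Measurable f) {C : ℝ} (hC : ∀ x, |f x| ≤ C) {m : ℕ} (hm : m ≠ 0) {η : ℝ}
    (hη0 : 0 < η) (hη1 : η ≤ 1) :
    haveI := isMarkovKernel_nHit κ k
    (Kernel.trajMeasure (X := fun _ : ℕ => Ω) μ₀
          (fun n : ℕ => (nHit κ k).comap (fun y : (i : ↥(Finset.Iic n)) → Ω =>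
            y ⟨n, Finset.mem_Iic.2 le_rfl⟩) (measurable_pi_apply _))).real
        {x | 4 * (C + |∫ z, f z ∂π|) / ((1 - (1 - ε.toReal) ^ k) * m)
              + Real.sqrt (8 * (C + |∫ z, f z ∂π|) ^ 2 * Real.log (2 / η)
                  / ((1 - (1 - ε.toReal) ^ k) ^ 2 * m))
            < |(∑ i ∈ Finset.range m, f (x i)) / m - ∫ z, f z ∂π|}
      ≤ η := by
  haveI := isMarkovKernel_nHit κ k
  have hε1 := eps_le_one_of_doeblin hmin
  have h := chain_confidence_of_doeblin (κ := nHit κ k) (μ₀ := μ₀) (invariant_nHit hπ k)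
    (doeblin_nHit_of_doeblin hπ hmin k) (eps_nHit_pos hε0 hk) hf hC hm hη0 hη1
  rw [toReal_one_sub_pow ε hε1 k] at h
  exact h

/-- **Certified burn-in of the thinned sampler, per recorded sample**: same hypotheses;
`|E_{μ₀}[f(X_t)] − πf| ≤ (1 − ε_k/2)ᵗ (C + |πf|)` for every `t`. -/
theorem thinnedChain_bias_le_of_doeblin (hπ : Kernel.Invariant κ π)
    (hmin : ∀ x {B : Set Ω}, MeasurableSet B → ε * π B ≤ κ x B) (hε0 : 0 < ε) {k : ℕ} (hk : k ≠ 0)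
    {f : Ω → ℝ} (hf : Measurable f) {C : ℝ} (hC : ∀ x, |f x| ≤ C) (t : ℕ) :
    haveI := isMarkovKernel_nHit κ k
    |∫ x, f (x t) ∂(Kernel.trajMeasure (X := fun _ : ℕ => Ω) μ₀
        (fun n : ℕ => (nHit κ k).comap (fun h : (i : ↥(Finset.Iic n)) → Ω =>
          h ⟨n, Finset.mem_Iic.2 le_rfl⟩) (measurable_pi_apply _))) - ∫ x, f x ∂π|
      ≤ (1 - (1 - (1 - ε.toReal) ^ k) / 2) ^ t * (C + |∫ x, f x ∂π|) := by
  haveI := isMarkovKernel_nHit κ k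
  have hε1 := eps_le_one_of_doeblin hmin
  have h := chain_bias_le_of_doeblin (κ := nHit κ k) (μ₀ := μ₀) (invariant_nHit hπ k)
    (doeblin_nHit_of_doeblin hπ hmin k) (eps_nHit_pos hε0 hk) hf hC t
  have hdiv : ((1 - (1 - ε) ^ k) / 2).toReal = (1 - (1 - ε.toReal) ^ k) / 2 := by
    rw [ENNReal.toReal_div, toReal_one_sub_pow ε hε1 k, ENNReal.toReal_ofNat]
  rw [hdiv] at h
  exact h

/-- **`τ_int` of the thinned sampler, in units of recorded samples**: same hypotheses, `f` bounded
measurable `π`-centred: `τ_int(f; κ^k) ≤ 1/ε_k − 1/2` on the tree's `Scoring.tauInt`. -/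
theorem thinnedChain_tauInt_le_of_doeblin (hπ : Kernel.Invariant κ π)
    (hmin : ∀ x {B : Set Ω}, MeasurableSet B → ε * π B ≤ κ x B) (hε0 : 0 < ε) {k : ℕ} (hk : k ≠ 0)
    {f : Ω → ℝ} (hf : Measurable f) {C : ℝ} (hC : ∀ x, |f x| ≤ C) (hf0 : ∫ x, f x ∂π = 0) :
    haveI := isMarkovKernel_nHit κ k
    tauInt (fun t => autocov (nHit κ k) π f t / autocov (nHit κ k) π f 0)
      ≤ 1 / (1 - (1 - ε.toReal) ^ k) - 1 / 2 := by
  haveI := isMarkovKernel_nHit κ k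
  have hε1 := eps_le_one_of_doeblin hmin
  have h := tauInt_le_of_doeblin (κ := nHit κ k) (invariant_nHit hπ k)
    (doeblin_nHit_of_doeblin hπ hmin k) (eps_nHit_pos hε0 hk) hf hC hf0
  rw [toReal_one_sub_pow ε hε1 k] at h
  exact h

omit [IsProbabilityMeasure μ₀] [IsProbabilityMeasure π] in
/-- The thinned sampler's autocovariances ARE the `κ`-chain's at lags `k t`:
`autocov (nHit κ k) π f t = autocov κ π f (k t)` (Chapman–Kolmogorov on observables). -/
theorem autocov_nHit (k : ℕ) {f : Ω → ℝ} (hf : Measurable f) {C : ℝ} (hC : ∀ x, |f x| ≤ C)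
    (t : ℕ) : autocov (nHit κ k) π f t = autocov κ π f (k * t) := by
  unfold autocov
  rw [iterate_kop_nHit κ k hf hC t]

end ThinnedChain

end Summit.Ventures.LatticeQCDFlow.Scoring

end
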